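import Summits.BirchSwinnertonDyer.BirchSwinnertonDyer.Theses.DefiniteGrossPeriodAtTwo
import HarnessLib

/-!
# Route `DefiniteGrossPeriodAtTwo`: the join `Assembly` (item stmt-BirchSwinnertonDyer-23670)

The route's assembly item (stmt-BirchSwinnertonDyer-23670)
`Summit.BirchSwinnertonDyer.BirchSwinnertonDyer.Theses.DefiniteGrossPeriodAtTwo.Assembly :=
  GrossPeriodExactnessAtTwo → GrossPeriodAnalyticShaAtTwo → KatoBoundAtTwo → DefiniteGrossDataSupply → DefiniteDescentAtTwo → OffDefiniteHabitatAtTwo → Summit.BirchSwinnertonDyer.BirchSwinnertonDyer.Rank1Residual.NonCMAtTwo`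
is, literally, the type of the route's planner-authored deciding theorem `Summit.BirchSwinnertonDyer.BirchSwinnertonDyer.Theses.DefiniteGrossPeriodAtTwo.closes`
(D-0027 §2.1; proved in the route file itself with the standard axioms, its hypotheses being the
route's items and its conclusion the route's registered leaf). Nothing is asserted here: every item of
the chain stays a hypothesis of `Assembly` itself; this file is ONE application of `closes`, closing the
bookkeeping item only. No crux of the route is advanced and BSD is not proved by this.
-/

set_option autoImplicit false
set_option linter.dupNamespace false

namespace Summit.BirchSwinnertonDyer.BirchSwinnertonDyer.Theorems

/-- **The join of route `DefiniteGrossPeriodAtTwo` holds**: the route's items, taken as hypotheses in the order of the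
assembly chain, imply its leaf `Summit.BirchSwinnertonDyer.BirchSwinnertonDyer.Rank1Residual.NonCMAtTwo` — by the route's deciding theorem `closes`, whose type this
literally is. [folklore] -/
theorem definiteGrossPeriodAtTwo_assembly_proof :
    Summit.BirchSwinnertonDyer.BirchSwinnertonDyer.Theses.DefiniteGrossPeriodAtTwo.Assembly :=
  Summit.BirchSwinnertonDyer.BirchSwinnertonDyer.Theses.DefiniteGrossPeriodAtTwo.closes

end Summit.BirchSwinnertonDyer.BirchSwinnertonDyer.Theorems
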